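import Literature.MathematicalPhysics.KineticTheory.SiteChainResponseBackward
import HarnessLib

/-!
# The backward identity for energy-weighted pairings of site-inhomogeneous chains: removing the truncation

Topic `Literature/MathematicalPhysics/KineticTheory`, grouping namespace `…KineticTheory.HeatConduction`.
Dominated-convergence inputs for passing `R = n + 1 → ∞` in the truncated backward identity
(`SiteChainResponseBackward.lean`) of a uniformly confining site-dependent chain, under the
exponential moment bound (EM) `∫ e^{ϑH} dP_t(x,·) ≤ K e^{rt} e^{ϑH(x)}` of `SiteChainResponsePairing.lean`
(`K, r ≥ 0`), for an observable `φ` with `|φ| ≤ C e^{ϑH}` and an exponent `θ` with `e^{(θ+ϑ)H}`,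
`(1 + p_0² + p_{N-1}²) e^{(θ+ϑ)H}` Lebesgue integrable:

* `tendsto_integral_cutoff_diag` — `∫ χ_R e^{θH} χ_R φ dx → ∫ e^{θH} φ dx`;
* `tendsto_integral_cutoff_lhs` — `∫ χ_R e^{θH} P_t(χ_R φ) dx → ∫ e^{θH} P_t φ dx`;
* `exists_bound_cutoff_gen` — `|P_s(χ_R φ)(x) · L̂(χ_R e^{θH})(x)| ≤ K' e^{rs} (1 + p_0² + p_{N-1}²) e^{(θ+ϑ)H(x)}`
  uniformly in `R ≥ 1`;
* `tendsto_integral_cutoff_gen` — `∫ P_s(χ_R φ) L̂(χ_R e^{θH}) dx → ∫ P_s φ · L̂(e^{θH}) dx` with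
  `L̂(e^{θH}) = γ e^{θH} (T_L(θ²p_0² + θ) + θp_0² + T_R(θ²p_{N-1}² + θ) + θp_{N-1}²)`.

## References

* N. Cuneo, J.-P. Eckmann, M. Hairer, L. Rey-Bellet, Electron. J. Probab. **23** (2018) no. 55, §3.1.
* D. W. Stroock, S. R. S. Varadhan, *Multidimensional Diffusion Processes* (1979), §3.1.
-/

noncomputable section

open MeasureTheory ProbabilityTheory Filter Topology Set
open scoped NNReal ENNReal ContDiff

namespace Literature.MathematicalPhysics.KineticTheory.HeatConduction

open Literature.Probability.Process Literature.MathematicalPhysics.KineticTheory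

variable {N : ℕ}

namespace SiteChain.UniformlyConfining

variable {P : SiteChain} (hP : P.UniformlyConfining)
include hP

/-! ### The truncated observable -/

/-- The truncated observable `χ(H/R) φ` is bounded (continuous with compact support, `R > 0`). [folklore] -/
theorem exists_bound_cutoff_mul (N : ℕ) {φ : PhaseSpace N → ℝ} (hφc : Continuous φ) {R : ℝ} (hR : 0 < R) :
    ∃ B : ℝ, ∀ y : PhaseSpace N, ‖smoothCutoff (P.hamiltonian N y / R) * φ y‖ ≤ B := by
  have hc : Continuous fun y : PhaseSpace N => smoothCutoff (P.hamiltonian N y / R) * φ y :=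
    ((contDiff_smoothCutoff (n := 0)).continuous.comp ((hP.contDiff_hamiltonian N).continuous.div_const R)).mul hφc
  refine hc.bounded_above_of_compact_support (HasCompactSupport.intro (hP.isCompact_setOf_hamiltonian_le N (2 * R))
    fun y hy => ?_)
  simp only [Set.mem_setOf_eq, not_le] at hy
  rw [smoothCutoff_of_two_le ((le_div_iff₀ hR).2 hy.le), zero_mul]

/-- The forecast of the truncated observable is continuous in the starting point (Feller). [folklore] -/
theorem continuous_integral_cutoff_langevinKernel (N : ℕ) (T_L T_R : ℝ) {φ : PhaseSpace N → ℝ}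
    (hφc : Continuous φ) (t : ℝ≥0) {R : ℝ} (hR : 0 < R) :
    Continuous fun x : PhaseSpace N =>
      ∫ y, smoothCutoff (P.hamiltonian N y / R) * φ y ∂(P.langevinKernel N T_L T_R t x) := by
  obtain ⟨B, hB⟩ := hP.exists_bound_cutoff_mul N hφc hR
  exact hP.continuous_integral_langevinKernel N T_L T_R t
    (((contDiff_smoothCutoff (n := 0)).continuous.comp ((hP.contDiff_hamiltonian N).continuous.div_const R)).mul
      hφc) hB

/-! ### The three limits -/

section Limits

variable {T_L T_R : ℝ} {ϑ K r : ℝ}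
  (hK : ∀ (t : ℝ≥0) (x : PhaseSpace N),
    ∫⁻ y, ENNReal.ofReal (Real.exp (ϑ * P.hamiltonian N y)) ∂(P.langevinKernel N T_L T_R t x) ≤
      ENNReal.ofReal (K * Real.exp (r * t) * Real.exp (ϑ * P.hamiltonian N x)))
  (hK0 : 0 ≤ K) {θ : ℝ}
  (hθ0 : Integrable fun x : PhaseSpace N => Real.exp ((θ + ϑ) * P.hamiltonian N x))
  {φ : PhaseSpace N → ℝ} (hφc : Continuous φ) {C : ℝ}
  (hφ : ∀ y, |φ y| ≤ C * Real.exp (ϑ * P.hamiltonian N y))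
include hθ0 hφc hφ

/-- **Limit of the diagonal term**: `∫ χ_R e^{θH} χ_R φ dx → ∫ e^{θH} φ dx` (`R = n + 1 → ∞`). [folklore] -/
theorem tendsto_integral_cutoff_diag :
    Tendsto (fun n : ℕ => ∫ x, (smoothCutoff (P.hamiltonian N x / (n + 1)) * Real.exp (θ * P.hamiltonian N x)) *
        (smoothCutoff (P.hamiltonian N x / (n + 1)) * φ x))
      atTop (𝓝 (∫ x, Real.exp (θ * P.hamiltonian N x) * φ x)) := by
  set Hm := P.hamiltonian N with hHm
  have hHc : Continuous Hm := (hP.contDiff_hamiltonian N).continuous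
  have hsc : Continuous smoothCutoff := (contDiff_smoothCutoff (n := 0)).continuous
  have hC : 0 ≤ C := by
    have := (abs_nonneg _).trans (hφ 0)
    exact nonneg_of_mul_nonneg_left this (Real.exp_pos _)
  refine tendsto_integral_of_dominated_convergence (fun x => C * Real.exp ((θ + ϑ) * Hm x))
    (fun n => ?_) (hθ0.const_mul C) (fun n => Eventually.of_forall fun x => ?_) (Eventually.of_forall fun x => ?_)
  · exact (((hsc.comp (hHc.div_const _)).mul (Real.continuous_exp.comp (continuous_const.mul hHc))).mul
      ((hsc.comp (hHc.div_const _)).mul hφc)).aestronglyMeasurable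
  · rw [Real.norm_eq_abs, abs_mul, add_mul, Real.exp_add]
    have hw := truncExpWeight_mem_Icc (θ := θ) ((n : ℝ) + 1) (Hm x)
    calc |smoothCutoff (Hm x / (n + 1)) * Real.exp (θ * Hm x)| * |smoothCutoff (Hm x / (n + 1)) * φ x|
        ≤ Real.exp (θ * Hm x) * (C * Real.exp (ϑ * Hm x)) := by
          refine mul_le_mul ?_ ?_ (abs_nonneg _) (Real.exp_pos _).le
          · rw [abs_of_nonneg hw.1]; exact hw.2
          · rw [abs_mul, abs_of_nonneg (smoothCutoff_nonneg _)]
            calc smoothCutoff (Hm x / (n + 1)) * |φ x| ≤ 1 * |φ x| :=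
                  mul_le_mul_of_nonneg_right (smoothCutoff_le_one _) (abs_nonneg _)
              _ = |φ x| := one_mul _
              _ ≤ C * Real.exp (ϑ * Hm x) := hφ x
      _ = C * (Real.exp (θ * Hm x) * Real.exp (ϑ * Hm x)) := by ring
  · refine tendsto_const_nhds.congr' ?_
    obtain ⟨n₀, hn₀⟩ := exists_nat_ge (Hm x)
    filter_upwards [eventually_ge_atTop n₀] with n hn
    have hlt : Hm x < n + 1 := by
      calc Hm x ≤ n₀ := hn₀
        _ ≤ n := by exact_mod_cast hn
        _ < n + 1 := lt_add_one _
    rw [(truncExpWeight_derivs_of_lt (θ := θ) (by positivity) hlt).1,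
      smoothCutoff_of_le_one ((div_le_one (by positivity)).2 hlt.le), one_mul]

include hK hK0 in
/-- **Limit of the left-hand side**: `∫ χ_R e^{θH} P_t(χ_R φ) dx → ∫ e^{θH} P_t φ dx` (`R = n + 1 → ∞`).
[folklore] -/
theorem tendsto_integral_cutoff_lhs (t : ℝ≥0) :
    Tendsto (fun n : ℕ => ∫ x, (smoothCutoff (P.hamiltonian N x / (n + 1)) * Real.exp (θ * P.hamiltonian N x)) *
        ∫ y, smoothCutoff (P.hamiltonian N y / (n + 1)) * φ y ∂(P.langevinKernel N T_L T_R t x))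
      atTop (𝓝 (∫ x, Real.exp (θ * P.hamiltonian N x) * ∫ y, φ y ∂(P.langevinKernel N T_L T_R t x))) := by
  set Hm := P.hamiltonian N with hHm
  have hHc : Continuous Hm := (hP.contDiff_hamiltonian N).continuous
  have hsc : Continuous smoothCutoff := (contDiff_smoothCutoff (n := 0)).continuous
  have hC : 0 ≤ C := by
    have := (abs_nonneg _).trans (hφ 0)
    exact nonneg_of_mul_nonneg_left this (Real.exp_pos _)
  set M : ℝ := C * (K * Real.exp (r * t)) with hM
  refine tendsto_integral_of_dominated_convergence (fun x => M * Real.exp ((θ + ϑ) * Hm x))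
    (fun n => ?_) (hθ0.const_mul M) (fun n => Eventually.of_forall fun x => ?_) (Eventually.of_forall fun x => ?_)
  · exact (((hsc.comp (hHc.div_const _)).mul (Real.continuous_exp.comp (continuous_const.mul hHc))).mul
      (hP.continuous_integral_cutoff_langevinKernel N T_L T_R hφc t (by positivity : (0:ℝ) < n + 1))).aestronglyMeasurable
  · have hin := hP.abs_integral_langevinKernel_mul_le hK hφ hK0 t x
      (g := fun y => smoothCutoff (Hm y / (n + 1))) (fun y => by
        rw [abs_of_nonneg (smoothCutoff_nonneg _)]; exact smoothCutoff_le_one _)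
    have hw := truncExpWeight_mem_Icc (θ := θ) ((n : ℝ) + 1) (Hm x)
    rw [Real.norm_eq_abs, abs_mul, add_mul, Real.exp_add]
    calc |smoothCutoff (Hm x / (n + 1)) * Real.exp (θ * Hm x)| *
          |∫ y, smoothCutoff (Hm y / (n + 1)) * φ y ∂(P.langevinKernel N T_L T_R t x)|
        ≤ Real.exp (θ * Hm x) * (C * (K * Real.exp (r * t) * Real.exp (ϑ * Hm x))) := by
          refine mul_le_mul ?_ hin (abs_nonneg _) (Real.exp_pos _).le
          rw [abs_of_nonneg hw.1]; exact hw.2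
      _ = M * (Real.exp (θ * Hm x) * Real.exp (ϑ * Hm x)) := by rw [hM]; ring
  · have h1 : Tendsto (fun n : ℕ => smoothCutoff (Hm x / (n + 1)) * Real.exp (θ * Hm x)) atTop
        (𝓝 (Real.exp (θ * Hm x))) := by
      refine tendsto_const_nhds.congr' ?_
      obtain ⟨n₀, hn₀⟩ := exists_nat_ge (Hm x)
      filter_upwards [eventually_ge_atTop n₀] with n hn
      have hlt : Hm x < n + 1 := by
        calc Hm x ≤ n₀ := hn₀
          _ ≤ n := by exact_mod_cast hn
          _ < n + 1 := lt_add_one _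
      rw [(truncExpWeight_derivs_of_lt (θ := θ) (by positivity) hlt).1]
    exact h1.mul (hP.tendsto_integral_cutoff_langevinKernel hK hφc hφ t x)

omit hθ0 hφc
variable (hN : 0 < N) (hTL : 0 ≤ T_L) (hTR : 0 ≤ T_R) (hr : 0 ≤ r)
  (hθ1 : Integrable fun x : PhaseSpace N =>
    (1 + x.2 ⟨0, hN⟩ ^ 2 + x.2 ⟨N - 1, by omega⟩ ^ 2) * Real.exp ((θ + ϑ) * P.hamiltonian N x))
include hK hK0 hTL hTR

/-- **Uniform majorant of the generator-pairing integrand**: for all `n`, `s ≥ 0`, `x`,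
`|P_s(χ_R φ)(x) · L̂(χ_R e^{θH})(x)| ≤ K' e^{rs} (1 + p_0² + p_{N-1}²) e^{(θ+ϑ)H(x)}` (`R = n + 1`). [folklore] -/
theorem exists_bound_cutoff_gen :
    ∃ K' : ℝ, 0 ≤ K' ∧ ∀ (n : ℕ) (s : ℝ≥0) (x : PhaseSpace N),
      |(∫ y, smoothCutoff (P.hamiltonian N y / (n + 1)) * φ y ∂(P.langevinKernel N T_L T_R s x)) *
          sdeGenerator (fun y => -P.langevinDrift N y) (P.noiseVecL N T_L) (P.noiseVecR N T_R)
            (fun y => smoothCutoff (P.hamiltonian N y / (n + 1)) * Real.exp (θ * P.hamiltonian N y)) x| ≤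
        K' * Real.exp (r * s) *
          ((1 + x.2 ⟨0, hN⟩ ^ 2 + x.2 ⟨N - 1, by omega⟩ ^ 2) * Real.exp ((θ + ϑ) * P.hamiltonian N x)) := by
  set Hm := P.hamiltonian N with hHm
  have hH2 : ContDiff ℝ 2 Hm := hP.contDiff_hamiltonian N
  have hγ' : 0 ≤ P.γ := hP.γ_nonneg
  have hU1 : ∀ i, ContDiff ℝ 1 (P.U i) := fun i => (hP.contDiff_U i).of_le (by norm_num)
  have hV1 : ∀ i, ContDiff ℝ 1 (P.V i) := fun i => (hP.contDiff_V i).of_le (by norm_num)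
  have hC : 0 ≤ C := by
    have := (abs_nonneg _).trans (hφ 0)
    exact nonneg_of_mul_nonneg_left this (Real.exp_pos _)
  obtain ⟨A, hA0, hA⟩ := exists_bound_derivs_truncExpWeight θ
  refine ⟨C * K * (P.γ * ((A + A) * (T_L + T_R + 2))), by positivity, fun n s x => ?_⟩
  have hR1 : (1 : ℝ) ≤ n + 1 := by simp
  obtain ⟨hA1, hA2⟩ := hA (n + 1) hR1 (Hm x)
  have hGnb : |sdeGenerator (fun y => -P.langevinDrift N y) (P.noiseVecL N T_L) (P.noiseVecR N T_R)
        (fun y => smoothCutoff (Hm y / (n + 1)) * Real.exp (θ * Hm y)) x| ≤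
      P.γ * ((A + A) * (T_L + T_R + 2) * (1 + x.2 ⟨0, hN⟩ ^ 2 + x.2 ⟨N - 1, by omega⟩ ^ 2) *
        Real.exp (θ * Hm x)) :=
    P.abs_sdeGenerator_negLangevinDrift_comp_hamiltonian_le hN hγ' hTL hTR hU1 hV1 hH2
      (contDiff_two_truncExpWeight θ (n + 1)) (hasDerivAt_truncExpWeight θ (n + 1))
      (hasDerivAt_deriv_truncExpWeight θ (n + 1)) x hA1 hA2
  have hin := hP.abs_integral_langevinKernel_mul_le hK hφ hK0 s x
    (g := fun y => smoothCutoff (Hm y / (n + 1))) (fun y => by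
      rw [abs_of_nonneg (smoothCutoff_nonneg _)]; exact smoothCutoff_le_one _)
  rw [abs_mul]
  calc |∫ y, smoothCutoff (Hm y / (n + 1)) * φ y ∂(P.langevinKernel N T_L T_R s x)| *
        |sdeGenerator (fun y => -P.langevinDrift N y) (P.noiseVecL N T_L) (P.noiseVecR N T_R)
          (fun y => smoothCutoff (Hm y / (n + 1)) * Real.exp (θ * Hm y)) x|
      ≤ (C * (K * Real.exp (r * s) * Real.exp (ϑ * Hm x))) *
        (P.γ * ((A + A) * (T_L + T_R + 2) * (1 + x.2 ⟨0, hN⟩ ^ 2 + x.2 ⟨N - 1, by omega⟩ ^ 2) *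
          Real.exp (θ * Hm x))) :=
        mul_le_mul hin hGnb (abs_nonneg _) (by positivity)
    _ = C * K * (P.γ * ((A + A) * (T_L + T_R + 2))) * Real.exp (r * s) *
        ((1 + x.2 ⟨0, hN⟩ ^ 2 + x.2 ⟨N - 1, by omega⟩ ^ 2) * Real.exp ((θ + ϑ) * Hm x)) := by
        rw [show (θ + ϑ) * Hm x = θ * Hm x + ϑ * Hm x by ring, Real.exp_add]; ring

include hφc hθ1 in
/-- **Limit of the generator pairing at a fixed time** `s ≥ 0`:
`∫ P_s(χ_R φ) · L̂(χ_R e^{θH}) dx → ∫ P_s φ · L̂(e^{θH}) dx` (`R = n + 1 → ∞`), where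
`L̂(e^{θH}) = γ e^{θH} (T_L (θ² p_0² + θ) + θ p_0² + T_R (θ² p_{N-1}² + θ) + θ p_{N-1}²)`. [folklore] -/
theorem tendsto_integral_cutoff_gen (s : ℝ≥0) :
    Tendsto (fun n : ℕ => ∫ x,
        (∫ y, smoothCutoff (P.hamiltonian N y / (n + 1)) * φ y ∂(P.langevinKernel N T_L T_R s x)) *
          sdeGenerator (fun y => -P.langevinDrift N y) (P.noiseVecL N T_L) (P.noiseVecR N T_R)
            (fun y => smoothCutoff (P.hamiltonian N y / (n + 1)) * Real.exp (θ * P.hamiltonian N y)) x)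
      atTop (𝓝 (∫ x, (∫ y, φ y ∂(P.langevinKernel N T_L T_R s x)) *
        (Real.exp (θ * P.hamiltonian N x) *
          (P.γ * (T_L * (θ ^ 2 * x.2 ⟨0, hN⟩ ^ 2 + θ) + θ * x.2 ⟨0, hN⟩ ^ 2 +
            (T_R * (θ ^ 2 * x.2 ⟨N - 1, by omega⟩ ^ 2 + θ) + θ * x.2 ⟨N - 1, by omega⟩ ^ 2)))))) := by
  set Hm := P.hamiltonian N with hHm
  have hH2 : ContDiff ℝ 2 Hm := hP.contDiff_hamiltonian N
  have hU1 : ∀ i, ContDiff ℝ 1 (P.U i) := fun i => (hP.contDiff_U i).of_le (by norm_num)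
  have hV1 : ∀ i, ContDiff ℝ 1 (P.V i) := fun i => (hP.contDiff_V i).of_le (by norm_num)
  have hY'c : Continuous fun y => -P.langevinDrift N y :=
    (P.contDiff_one_langevinDrift hP.contDiff_U hP.contDiff_V N).continuous.neg
  have hLT : 0 ≤ P.γ * T_L := mul_nonneg hP.γ_nonneg hTL
  have hRT : 0 ≤ P.γ * T_R := mul_nonneg hP.γ_nonneg hTR
  -- closed form of the truncated generator
  have hGn : ∀ (n : ℕ) (x : PhaseSpace N),
      sdeGenerator (fun y => -P.langevinDrift N y) (P.noiseVecL N T_L) (P.noiseVecR N T_R)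
        (fun y => smoothCutoff (Hm y / (n + 1)) * Real.exp (θ * Hm y)) x =
      P.γ * ((T_L * ((Real.exp (θ * Hm x) * (θ ^ 2 * smoothCutoff (Hm x / (n + 1)) +
          2 * θ * (deriv smoothCutoff (Hm x / (n + 1)) / (n + 1)) +
          deriv (deriv smoothCutoff) (Hm x / (n + 1)) / (n + 1) ^ 2)) * x.2 ⟨0, hN⟩ ^ 2 +
          Real.exp (θ * Hm x) * (θ * smoothCutoff (Hm x / (n + 1)) + deriv smoothCutoff (Hm x / (n + 1)) / (n + 1))) +
          Real.exp (θ * Hm x) * (θ * smoothCutoff (Hm x / (n + 1)) + deriv smoothCutoff (Hm x / (n + 1)) / (n + 1)) *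
            x.2 ⟨0, hN⟩ ^ 2) +
        (T_R * ((Real.exp (θ * Hm x) * (θ ^ 2 * smoothCutoff (Hm x / (n + 1)) +
          2 * θ * (deriv smoothCutoff (Hm x / (n + 1)) / (n + 1)) +
          deriv (deriv smoothCutoff) (Hm x / (n + 1)) / (n + 1) ^ 2)) * x.2 ⟨N - 1, by omega⟩ ^ 2 +
          Real.exp (θ * Hm x) * (θ * smoothCutoff (Hm x / (n + 1)) + deriv smoothCutoff (Hm x / (n + 1)) / (n + 1))) +
          Real.exp (θ * Hm x) * (θ * smoothCutoff (Hm x / (n + 1)) + deriv smoothCutoff (Hm x / (n + 1)) / (n + 1)) *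
            x.2 ⟨N - 1, by omega⟩ ^ 2)) :=
    fun n x => P.sdeGenerator_negLangevinDrift_comp_hamiltonian hN hLT hRT hU1 hV1 hH2
      (contDiff_two_truncExpWeight θ (n + 1)) (hasDerivAt_truncExpWeight θ (n + 1))
      (hasDerivAt_deriv_truncExpWeight θ (n + 1)) x
  obtain ⟨K', hK'0, hK'⟩ := hP.exists_bound_cutoff_gen hK hK0 hφ hN hTL hTR (θ := θ) (r := r)
  -- dominated convergence
  set M : ℝ := K' * Real.exp (r * s) with hM
  refine tendsto_integral_of_dominated_convergence
    (fun x => M * ((1 + x.2 ⟨0, hN⟩ ^ 2 + x.2 ⟨N - 1, by omega⟩ ^ 2) * Real.exp ((θ + ϑ) * Hm x)))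
    (fun n => ?_) (hθ1.const_mul M) (fun n => Eventually.of_forall fun x => ?_) (Eventually.of_forall fun x => ?_)
  · exact ((hP.continuous_integral_cutoff_langevinKernel N T_L T_R hφc s (by positivity : (0:ℝ) < n + 1)).mul
      (continuous_sdeGenerator _ _ hY'c (P.contDiff_truncExpWeight_hamiltonian hH2 θ (n + 1)))).aestronglyMeasurable
  · rw [Real.norm_eq_abs]
    exact hK' n s x
  · have hlim : Tendsto (fun n : ℕ => sdeGenerator (fun y => -P.langevinDrift N y) (P.noiseVecL N T_L)
        (P.noiseVecR N T_R) (fun y => smoothCutoff (Hm y / (n + 1)) * Real.exp (θ * Hm y)) x) atTop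
        (𝓝 (Real.exp (θ * Hm x) *
          (P.γ * (T_L * (θ ^ 2 * x.2 ⟨0, hN⟩ ^ 2 + θ) + θ * x.2 ⟨0, hN⟩ ^ 2 +
            (T_R * (θ ^ 2 * x.2 ⟨N - 1, by omega⟩ ^ 2 + θ) + θ * x.2 ⟨N - 1, by omega⟩ ^ 2))))) := by
      refine tendsto_const_nhds.congr' ?_
      obtain ⟨n₀, hn₀⟩ := exists_nat_ge (Hm x)
      filter_upwards [eventually_ge_atTop n₀] with n hn
      have hR : (0 : ℝ) < n + 1 := by positivity
      have hlt : Hm x < n + 1 := by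
        calc Hm x ≤ n₀ := hn₀
          _ ≤ n := by exact_mod_cast hn
          _ < n + 1 := lt_add_one _
      obtain ⟨-, h1, h2⟩ := truncExpWeight_derivs_of_lt (θ := θ) hR hlt
      rw [hGn n x, h1, h2]
      ring
    exact (hP.tendsto_integral_cutoff_langevinKernel hK hφc hφ s x).mul hlim

end Limits

end SiteChain.UniformlyConfining

end Literature.MathematicalPhysics.KineticTheory.HeatConduction
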